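/-
Copyright (c) 2026 the pub-hodgecm-mathlib formalisation cell (harness21).  Prover seat hodgecm-mathlib-A-p03 (g24); LEAD F0P3a-plan (g9) WORD T8-34 (C) «(L3)»,
architect A-p06 (g26) (MAP v2 WANT 2–5), 2026-09-01.
-/
import Mathlib.Tactic
import HarnessLib

/-!
# Flicker's unit orbital integrals for `U(3)` at an inert place — THE PRINTED CLOSED FORMS (Canad. J. Math. 50 (1998), Props. 11, 14, §6 p. 95)

Topic `NumberTheory/Rogawski1990` (road «D-N7-inert», letter N7-ns = [Rogawski1990, Prop. 4.9.1 (b)] at the inert places); namespace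
`Literature.NumberTheory.Rogawski1990.Flicker1998`.  DEFINITIONS ONLY (four computable `def`s = the printed closed forms; no theorem, no instance,
no notation, no named fact, no `sorry`); the algebra (Theorem 15) is the sequel `UnitFundamentalLemmaInertFlickerAlgebra`, the orbital-integral VALUES letter is «(L3-V)».  Cell `pub/hodgecm-mathlib`, crux H413 = `stmt-HodgeConjecture-24833`; (L3-A) of the census
`F0/P3a/A-p03/g24/CENSUS-L3-FlickerUnitOrbitalIntegrals.A-p03g24.md` (d034d73f).

THE MATHEMATICS [Flicker1998UnitaryFL].  `E∕F` an unramified quadratic extension of `p`-adic fields (`p ≠ 2`), `q` the residual cardinality of `F`,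
`G = U(2,1; E∕F)`, `K` its standard hyperspecial subgroup (`vol K = 1`), `t₀ = diag(a, b, c)` a regular element of the anisotropic `E`-split torus
`T = (E¹)³`, `N₁ = v(a − b)`, `N₂ = v(c − b)`, `N = v(a − c)` (so the two smallest of `N₁, N₂, N` are equal), `t₁, …, t₄` Flicker's representatives of the
four conjugacy classes in the stable class of `t₀` (Prop. 3 p. 78: `t₁ ∈ T₁ = h⁻¹Th` — torus parity `θ̄ = 0` —, `t₂, t₃, t₄ ∈ T₂ = (hr)⁻¹T hr` — `θ̄ = 1` —,
`t₃`, `t₄` with `(b, c)`, `(a, b)` swapped), `Φ(t) = ∫_{Z(t)∖G} 1_K(g⁻¹ t g) dg` (mass one on the compact `Z(t)`).  Flicker computes (Props. 11, 14, by a double-coset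
decomposition `G = ⊔ H u_m K` and explicit volumes) the CLOSED FORMS
* `Φ(t₁) = φ₀(N₁, N₂, N)` (Prop. 14, p. 94; `θ̄ = 0`) and `Φ(t₂) = φ₁(N₁, N)`, `Φ(t₃) = φ₁(N, N₁)`, `Φ(t₄) = φ₁(N₁, N₂)` (Prop. 11, p. 87; `θ̄ = 1`; p. 95: «`Φ(t₂)`
  depends only on `N₁, N₂, N` … `Φ(t₃) = φ(N, N₂, N₁)`, `Φ(t₄) = φ(N₁, N, N₂)`»),
recorded below as the computable `phiZero`, `phiOne : ℕ → ℕ → … → ℚ` EXACTLY AS PRINTED (floors `[x∕2]` = `Nat` division, parities `δ(2 ∣ n)` = `n % 2 = 0`), and the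
H-side value `Φ^st_{1_{K_H}}(t₀) = (q^N(q+1) − 2)∕(q − 1)` (p. 95, with Mars' lattice proof) as `phiH`.  THEOREM 15 (p. 95) — the unit fundamental lemma
`Δ_{G∕H}(t₀) Φ^κ_{1_K}(t₀) = Φ^st_{1_{K_H}}(t₀)` with `Δ_{G∕H}(t₀) = (−q)^{−N₁−N₂}` and `Φ^κ_{1_K}(t₀) = Φ(t₁) + Φ(t₂) − Φ(t₃) − Φ(t₄)` — is then the PURE
ALGEBRAIC IDENTITY **`flicker_theorem15`**: `φ₀(N₁,N₂,N) + φ₁(N₁,N) − φ₁(N,N₁) − φ₁(N₁,N₂) = (−q)^{N₁+N₂} · φ_H(N)` whenever the two smallest of `N₁, N₂, N`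
are equal, proved here by Flicker's three order cases (pp. 95–96) and the parities — kernel-checked.  It is (a) Flicker's §6 in the tree, and (b) the CONSISTENCY
CERTIFICATE of the cell's transcription of the printed constants of Props. 11∕14 (the orbital-integral VALUES themselves — the lattice counts — are the letter
«(L3-V)», cited not proved; this file asserts nothing about orbital integrals).
* `phiZero` (Prop. 14, `θ̄ = 0`), `phiOne` (Prop. 11, `θ̄ = 1`), `phiH` (p. 95), `phiKappa` (the `κ`-combination `φ₀ + φ₁ − φ₁∘(13) − φ₁∘(12)`).
HONEST LABEL: HC_CM is proved only modulo the printed citations until rung 0 closes; this file is arithmetic and pays no letter by itself.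

## References
* [Flicker1998UnitaryFL] Y. Z. Flicker, *Elementary proof of the fundamental lemma for a unitary group*, Canad. J. Math. 50 (1998), 74–98: Prop. 3 p. 78, Prop. 11
  p. 87, Prop. 14 p. 94, §6 Theorem 15 pp. 95–96 (and the Remark p. 95 for `Φ^st_{1_{K_H}}`).
* [Rogawski1990] J. D. Rogawski, *Automorphic Representations of Unitary Groups in Three Variables*, Ann. of Math. Stud. 123 (1990), §4.9 Prop. 4.9.1 (b) p. 55
  («the fundamental lemma for U(3) … proved in [BR₁]»).
* [BlasiusRogawski1992FL] D. Blasius, J. D. Rogawski, *Fundamental lemmas for U(3) and related groups*, CRM Montréal (1992), 363–394, §6 Prop. 6.2.1 (the same count).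
-/


namespace Literature.NumberTheory.Rogawski1990.Flicker1998

/-! ## §1 The printed closed forms -/

/-- **Flicker's `Φ(t_θ)` for the torus parity `θ̄ = 0`** (Prop. 14 p. 94), as a function of the residual cardinality `q` and the valuation triple
`(N₁, N₂, N)`: `−(q+1)∕(q⁴−1)·(1 + q^{2+4[N₁∕2]}) − (−q)^{N+N₁}∕(q−1) + δ(2 ∣ N+N₁)·(q+1)∕(q−1)·q^{2N₁+N}` if `N₁ < N`, and
`−(q+1)∕(q⁴−1)·(1 + q^{2+4[N∕2]}) − (−q)^{M+N}∕(q−1) + δ(2 ∣ M−N)·(q+1)∕(q−1)·q^{2N+M}` if `N ≤ N₁`, `M = max(N₁, N₂)`.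
[cite: Flicker1998UnitaryFL, Prop. 14 p. 94] -/
def phiZero (q N₁ N₂ N : ℕ) : ℚ :=
  if N₁ < N then
    -((q + 1 : ℚ) / ((q : ℚ) ^ 4 - 1)) * (1 + (q : ℚ) ^ (2 + 4 * (N₁ / 2))) - (-(q : ℚ)) ^ (N + N₁) / ((q : ℚ) - 1) +
      (if (N + N₁) % 2 = 0 then ((q + 1 : ℚ) / ((q : ℚ) - 1)) * (q : ℚ) ^ (2 * N₁ + N) else 0)
  else
    -((q + 1 : ℚ) / ((q : ℚ) ^ 4 - 1)) * (1 + (q : ℚ) ^ (2 + 4 * (N / 2))) - (-(q : ℚ)) ^ (max N₁ N₂ + N) / ((q : ℚ) - 1) +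
      (if (max N₁ N₂ - N) % 2 = 0 then ((q + 1 : ℚ) / ((q : ℚ) - 1)) * (q : ℚ) ^ (2 * N + max N₁ N₂) else 0)

/-- **Flicker's `Φ(t_θ)` for the torus parity `θ̄ = 1`** (Prop. 11 p. 87), as a function of `q` and `(N₁, N)` (it does not depend on `N₂`):
`(q+1)∕(q⁴−1)·(q^{4[(N+1)∕2]} − 1)` if `N ≤ N₁`, and `−(q+1)∕(q⁴−1)·(1 + q^{2+4[N₁∕2]}) + (−q)^{N+N₁}∕(q−1) + δ(2 ∣ N−1−N₁)·(q+1)∕(q−1)·q^{N+2N₁}` if `N > N₁`.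
[cite: Flicker1998UnitaryFL, Prop. 11 p. 87] -/
def phiOne (q N₁ N : ℕ) : ℚ :=
  if N ≤ N₁ then ((q + 1 : ℚ) / ((q : ℚ) ^ 4 - 1)) * ((q : ℚ) ^ (4 * ((N + 1) / 2)) - 1)
  else
    -((q + 1 : ℚ) / ((q : ℚ) ^ 4 - 1)) * (1 + (q : ℚ) ^ (2 + 4 * (N₁ / 2))) + (-(q : ℚ)) ^ (N + N₁) / ((q : ℚ) - 1) +
      (if (N - 1 - N₁) % 2 = 0 then ((q + 1 : ℚ) / ((q : ℚ) - 1)) * (q : ℚ) ^ (N + 2 * N₁) else 0)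

/-- **The H-side value** `Φ^st_{1_{K_H}}(t₀) = (q^N(q+1) − 2)∕(q−1)` (p. 95, [F1] Prop. 5; Mars' remark: the `E^×`-orbits of lattices in `E ≅ F²` are the
orders `R_E(j)`, `[R_E^× : R_E(j)^×] = q^{j−1}(q+1)` for `j ≥ 1`). [cite: Flicker1998UnitaryFL, §6 p. 95] -/
def phiH (q N : ℕ) : ℚ := ((q : ℚ) ^ N * (q + 1) - 2) / ((q : ℚ) - 1)

/-- **Flicker's `κ`-combination** `Φ^κ_{1_K}(t₀) = Φ(t₁) + Φ(t₂) − Φ(t₃) − Φ(t₄)` read on the closed forms: `φ₀(N₁,N₂,N) + φ₁(N₁,N) − φ₁(N,N₁) − φ₁(N₁,N₂)`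
(p. 95: `Φ(t₃) = φ(N, N₂, N₁)`, `Φ(t₄) = φ(N₁, N, N₂)` — `φ₁` reads the first and last slots). [cite: Flicker1998UnitaryFL, §6 p. 95] -/
def phiKappa (q N₁ N₂ N : ℕ) : ℚ := phiZero q N₁ N₂ N + phiOne q N₁ N - phiOne q N N₁ - phiOne q N₁ N₂

end Literature.NumberTheory.Rogawski1990.Flicker1998
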